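import Summits.ResolutionOfSingularities.ResolutionOfSingularities.Theorems.FaceCutCells
import Summits.ResolutionOfSingularities.ResolutionOfSingularities.Theorems.MaxContactCutCuspCut
import HarnessLib

/-!
# MaxContactCutFaceCut — decomp-res node «FaceCut» (lens-2 g26, critic row 208 CLEARED), tree file 6/6 of the node

Content VERBATIM from the decomp-res lens-2 g26 node `HOME/decomp-res-lens-2/g26/FaceCut.lean` (pin dd1d04c7; no
carry, imports the landed g24 node only; ns `…Theses.FaceCut` ↦ `…Theorems.FaceCut`, sub-namespace `FaceX` kept);
HOME = run/shared/lean/pub/decomp-res; critic CRITIC-LEDGER row 208 CLEARED; landing orders INBOX :1364 / rider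
10:41:11Z — provenance, critic text and the lens header in the first file of the node, `FaceCutKernels`.  `--kind
proof --supports stmt-ResolutionOfSingularities-29273`.

## This file

§F.2 THE WIRING of the node VERBATIM, BY NAME on the host route `MaxContactCut` (Theses cone; `namespace FaceX`), in
lens order: `FaceX.cuspGenericRung_of_ports` · `FaceX.closes` · `FaceX.closes_of_engines` · `FaceX.rungOne_iff` ·
`FaceX.cuspExit_iff` · `FaceX.leafSpecialRung_iff_cuspSpecialRung` — `FaceX.cuspGenericRung_of_ports` (g24's port
list with `hCuE : CuspExit` REPLACED by `(hFa : FaceCuspExit) (hNF : NonFaceCuspExit)`), **`FaceX.closes`** (=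
`CuspX.closes` BY NAME through the landed `CuspX.rungOne_iff`), `FaceX.closes_of_engines … (hS :
CuspX.CuspSpecialRung) : MaxContactCut.RungOne`, `FaceX.rungOne_iff`, `FaceX.cuspExit_iff`,
`FaceX.leafSpecialRung_iff_cuspSpecialRung` (tree aside 33866 ⟺ the cusp residual modulo the generic rung,
re-exported).  Imports the last `FaceCutCells…` part + `MaxContactCutCuspCut`; 0 sorry.

[WRITER NOTE (decomp-res writer g13): file split only (tree files ≤ 400 lines); sections, section variables / opens
and every declaration exactly as in the lens (the node's two HOME-only lines `linter.style.longFile` /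
dupNamespace-linter are dropped; the namespace-level `open` lines of the node are replayed in every part, the `open
…Theses` line only in the Theses-cone file `MaxContactCutFaceCut`); namespace renamed `…Theses.FaceCut` ↦
`…Theorems.FaceCut`; the cone-free parts import `…Theorems.CuspCutCells2` (the landed g24 cells) instead of the g24
wiring file, which only the cone file imports.]

(Sources: Hironaka1964 Ch. III §§1–3; CossartJannsenSaito2020 Ch. 2, Ch. 8–9; Matsumura1987 Thm 28.3, §29;
Cohen1946; ZariskiSamuelII Ch. VII §1; Bourbaki AC VII §3; CossartPiltant2008 Prop. 4.2, Lemma 4.3; Moh1987;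
Hauser2010Kangaroo; BierstoneGrigorievMilmanWlodarczyk2011 §3; Cutkosky2009.)
-/

open CategoryTheory AlgebraicGeometry TopologicalSpace IsLocalRing
open Literature.AlgebraicGeometry.Resolution
open Summit.ResolutionOfSingularities.ResolutionOfSingularities.Theorems
open Summit.ResolutionOfSingularities.ResolutionOfSingularities.Theorems.WeakOrderReduction
open Summit.ResolutionOfSingularities.ResolutionOfSingularities.Theorems.DeltaFaceCutClasses
open Summit.ResolutionOfSingularities.ResolutionOfSingularities.Theorems.RelativeDeltaCut
open Summit.ResolutionOfSingularities.ResolutionOfSingularities.Theorems.CurveLeafExit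
open Summit.ResolutionOfSingularities.ResolutionOfSingularities.Theorems.PinchCut
open Summit.ResolutionOfSingularities.ResolutionOfSingularities.Theorems.JetCut
open Summit.ResolutionOfSingularities.ResolutionOfSingularities.Theorems.PurityCut
open Summit.ResolutionOfSingularities.ResolutionOfSingularities.Theorems.SplitCut
open Summit.ResolutionOfSingularities.ResolutionOfSingularities.Theorems.CylinderCut
open Summit.ResolutionOfSingularities.ResolutionOfSingularities.Theorems.SpreadCut
open Summit.ResolutionOfSingularities.ResolutionOfSingularities.Theorems.CrossCut
open Summit.ResolutionOfSingularities.ResolutionOfSingularities.Theorems.DeepCrossCut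
open Summit.ResolutionOfSingularities.ResolutionOfSingularities.Theorems.OddCrossCut
open Summit.ResolutionOfSingularities.ResolutionOfSingularities.Theorems.CuspCut
open Summit.ResolutionOfSingularities.ResolutionOfSingularities.Theses

namespace Summit.ResolutionOfSingularities.ResolutionOfSingularities.Theorems.FaceCut

namespace FaceX

/-! ## §F.2  WIRING — `MaxContactCut.RungOne` BY NAME with the split engine; exact re-location (Theses cone) -/

/-- **`CuspGenericRung` from the ports with the WILD ENGINE SPLIT**: g24's `CuspX.cuspGenericRung_of_ports` with
`hCuE : CuspExit` replaced by the DECIDED `hFa : FaceCuspExit` and the RESIDUAL `hNF : NonFaceCuspExit`. [folklore] -/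
theorem cuspGenericRung_of_ports (hV : VeryNearCutClasses.VeryNearExit) (hD : DeltaPackageExit)
    (hU : UniformCurvePackageExit) (hR : RelCurvePackageExit) (hN : NormalConeJumpExit)
    (hM : MonomialPinchExit) (hC : FlatConeExit) (hGE : GrandExit) (hSE : SplitConeExit)
    (hJE : JetCylinderExit) (hX : MaxContactCut.MaxOrderThreefoldResolution) (hΓE : SpreadExit) (hXE : CrossExit)
    (hDXE : DeepCrossExit) (hNE : NodeExit) (hOXE : OddCrossExit) (hFa : FaceCuspExit) (hNF : NonFaceCuspExit)
    (hTaE : TameTwoExit) (hP : ∀ n : ℕ, 2 ≤ n → ComponentPackagePort n) (h1 : FaceFormCutClasses.OrderOneContact) :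
    CuspX.CuspGenericRung :=
  CuspX.cuspGenericRung_of_ports hV hD hU hR hN hM hC hGE hSE hJE hX hΓE hXE hDXE hNE hOXE
    (cuspExit_of_face_of_nonFace hFa hNF) hTaE hP h1

/-- **DECIDING IMPLICATION, BY NAME** (= g24's `CuspX.closes`): `MaxContactCut.RungOne` (29273) from the two halves.
[folklore] -/
theorem closes (hG : CuspX.CuspGenericRung) (hS : CuspX.CuspSpecialRung) : MaxContactCut.RungOne := CuspX.closes hG hS

/-- **`RungOne` BY NAME from the engines with the wild engine split, the ports and the located residual rung.** [folklore] -/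
theorem closes_of_engines (hV : VeryNearCutClasses.VeryNearExit) (hD : DeltaPackageExit)
    (hU : UniformCurvePackageExit) (hR : RelCurvePackageExit) (hN : NormalConeJumpExit)
    (hM : MonomialPinchExit) (hC : FlatConeExit) (hGE : GrandExit) (hSE : SplitConeExit)
    (hJE : JetCylinderExit) (hX : MaxContactCut.MaxOrderThreefoldResolution) (hΓE : SpreadExit) (hXE : CrossExit)
    (hDXE : DeepCrossExit) (hNE : NodeExit) (hOXE : OddCrossExit) (hFa : FaceCuspExit) (hNF : NonFaceCuspExit)
    (hTaE : TameTwoExit) (hP : ∀ n : ℕ, 2 ≤ n → ComponentPackagePort n) (h1 : FaceFormCutClasses.OrderOneContact)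
    (hS : CuspX.CuspSpecialRung) : MaxContactCut.RungOne :=
  closes (cuspGenericRung_of_ports hV hD hU hR hN hM hC hGE hSE hJE hX hΓE hXE hDXE hNE hOXE hFa hNF hTaE hP h1) hS

/-- **EXACT AT THE RUNG** (unchanged, g24): `RungOne ⟺ CuspGenericRung ∧ CuspSpecialRung`. [folklore] -/
theorem rungOne_iff : MaxContactCut.RungOne ↔ CuspX.CuspGenericRung ∧ CuspX.CuspSpecialRung := CuspX.rungOne_iff

/-- **EXACT AT THE ENGINE** (this node): the wild engine hypothesis of the decided half IS the pair (decided face engine,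
residual non-face engine). [folklore] -/
theorem cuspExit_iff : CuspExit ↔ FaceCuspExit ∧ NonFaceCuspExit := cuspExit_iff_face

/-- **THE TREE ASIDE 33866** `MaxContactCut.LeafSpecialRung` re-located modulo the decided half (g24, unchanged). [folklore] -/
theorem leafSpecialRung_iff_cuspSpecialRung (hG : CuspX.CuspGenericRung) :
    MaxContactCut.LeafSpecialRung ↔ CuspX.CuspSpecialRung :=
  CuspX.leafSpecialRung_iff_cuspSpecialRung hG

end FaceX

end Summit.ResolutionOfSingularities.ResolutionOfSingularities.Theorems.FaceCut
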